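import Mathlib
import HarnessLib
import HarnessLib.Audit
import Summits.HodgeConjecture.Statement
import Literature.AlgebraicGeometry.HodgeTheory.HodgeModelExistence
import Literature.NumberTheory.Transcendental.AnalytificationProjProofs
import Summits.HodgeConjecture.HodgeConjecture.Theorems.NodalSupportHodgeModels

/-!
Route: CrLinkCycles

# Route CrLinkCycles — HC on the contact link of the cone, where h dies: CR-cycles carry exactly the
algebraic classes

It suffices to show X = HODGE MODULO THE DIVISOR IDEAL (decl HodgeModDivisorIdeal): for every smooth
projective X/ℂ of dimension n,
1+p+q = n, every rational class c ∈ H^{2(1+p)}(X(ℂ);ℂ) of Hodge type (1+p,1+p) is z + d ∪ b with z ∈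
algebraicClasses X (1+p)
(= N^{1+p}H^{2(1+p)}), d ∈ algebraicClasses X 1 a divisor class and b ∈ H^{2p}(X(ℂ);ℂ). X is exactly
what the LINK MECHANISM of card
cr-link-maximally-complex-cycles (the only card realised) outputs: on the link L = Ĉ(X) ∩ S^{2N+1} ⊂
ℂ^{N+1} of the affine cone of
X ⊂ ℙ^N (unit circle bundle of O_X(−1), Boothby–Wang contact, π : L → X(ℂ)) the hyperplane class is
dead (ker π^* = h ∪ H^{2p},
Gysin), CR-cycles carrying π^*c exist iff c is algebraic mod ker π^* (cruxes LinkCycleExistence +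
LinkRigidity = Theorem T of the card),
and X → HodgeConjecture is Hodge-theoretic bookkeeping (support DivisorIdealLift + the summit's
anti-vacuity conjunct HodgeModels).
Lean: `∀ (n : ℕ) (X : Literature.AlgebraicGeometry.Motives.SchemeOver ℂ),
Literature.AlgebraicGeometry.Motives.IsSmoothProjective n X → ∀ (p q : ℕ), 1 + p + q = n → ∀ c :
Literature.AlgebraicGeometry.HodgeTheory.complexBetti X (2 * (1 + p)),
Literature.AlgebraicGeometry.HodgeTheory.IsRationalClass c →
Literature.AlgebraicGeometry.HodgeTheory.IsOfHodgeType n X (2 * (1 + p)) (1 + p) (1 + p) c → ∃ z ∈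
Literature.AlgebraicGeometry.HodgeTheory.algebraicClasses X (1 + p), ∃ d ∈
Literature.AlgebraicGeometry.HodgeTheory.algebraicClasses X 1, ∃ b :
Literature.AlgebraicGeometry.HodgeTheory.complexBetti X (2 * p), c = z +
Literature.AlgebraicTopology.SingularHomology.cupProduct (Nat.mul_add 2 1 p).symm d b`

## Assembly
Pure logic, checked by the planner (Sketch.lean rc 0, theorems glue_check and assembly_check,
sorry-free): given HodgeModels, LinkProjectionExists,
LinkCycleExistence, LinkRigidity, GysinKernelDivisorial and DivisorIdealLift, apply DivisorIdealLift
to HodgeModels and to the following proof of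
HodgeModDivisorIdeal: at (n, X, hX, p, q, hpq, c, hc, hh) obtain ⟨N, ι, hι⟩ := hX.isProjectiveOver;
haveI := hι; set L := {v | Σ‖v i‖² = 1 ∧ ∃ hv,
projPoint N [v] ∈ range (AlgPoints.map ι)} (membership ↔ is Iff.rfl); obtain π from
LinkProjectionExists, W from LinkCycleExistence, z from LinkRigidity,
(d, b) from GysinKernelDivisorial applied to c − z; conclude c = z + d ∪ b by `rw [← hb]; abel`.
ContactRepresentative (the typed second layer) and the
informal calibration item are deliberately outside the chain.

Rationale: WHY THIS LINE. Every geometric-measure-theory formulation of HC inside X (HarveyLawson2009 §6 =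
arXiv:0710.3921, HarveyLawson2006RelativeHodge = arXiv:math/0610533) fights the hyperplane class h:
minimisers in a + C·h^p need ballast growing with C, calibrated limits need positivity, and
'mass-minimisers need not be holomorphic' (HarveyLawson2009 §6.10). One real dimension up, on the
contact link L of the affine cone, h is exact (π^*ω = dη), the Stein filling Ĉ(X) ∩ B does all the
complex analysis once and for all — closed maximally complex cycles of dimension 2q+1 ≥ 3 bound
holomorphic chains (HarveyLawson1975, HarveyLawson1977, Harvey1977; HarveyLawson2004 §§1–2 READ:
"maximally complex submanifolds of higher dimension in ℂⁿ automatically bound holomorphic chains",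
boundary regularity a.e., scar sets allowed) — and King's tangent cone at the vertex (King1971) with
Chow (PROVED in the tree: Motives.coneChow) turns "π^*c is carried by a closed maximally complex
cycle" into "c is algebraic modulo ker π^* = h ∪ H" (Theorem T = crux LinkRigidity, typed here over
the tree's real carriers projPoint / AlgPoints.map / complexBetti / algebraicClasses with π
quantified, never assumed). Given T, HC is EQUIVALENT to an existence problem (crux
LinkCycleExistence) for closed solutions of a first-order pointwise CR condition on
(2q+1)-dimensional subsets of ONE compact contact manifold, in a FIXED class, with no positivity, no
ballast and no reference to h; its soft half (crux ContactRepresentative: carry π^*c by a compact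
C^1 CONTACT submanifold) is governed by the isocontact h-principle (Gromov1986 §3.4,
EliashbergMishachev2002 ch. 12 in codimension ≥ 4; CasalsPancholiPresas2021 in codimension 2), so
only formal obstructions remain there — and a formal obstruction for a Hodge class would be a new
TOPOLOGICAL obstruction to algebraicity (negative branch). Imported areas: several complex variables
/ GMT (boundaries of holomorphic chains, Federer's support theorem), contact topology (Boothby–Wang
BoothbyWang1958, h-principle), CR geometry of the Sasakian link; no physical analogy. No prior route
or negative (the negatives index of the summit is empty) uses the link, CR-cycles or an h-principle;
the 18 parallel Hodge routes opened today are arithmetic / motivic / variational.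

RANKED CRUXES. #0 HodgeModDivisorIdeal (target) — HODGE MODULO THE DIVISOR IDEAL (X of § Thesis):
for X smooth projective of dimension n, 1+p+q = n, every rational class c ∈ H^{2(1+p)}(X(ℂ);ℂ) of
Hodge type (1+p,1+p) is z + d ∪ b with z ∈ algebraicClasses X (1+p), d ∈ algebraicClasses X 1, b ∈
H^{2p}(X(ℂ);ℂ) arbitrary (ℂ-coefficients; single-product form = what the Gysin kernel gives with d =
h). Delivered by LinkProjectionExists + LinkCycleExistence + LinkRigidity + GysinKernelDivisorial
(pure logic, theorem glue_check of the planner sketch); implies HC by DivisorIdealLift. Codimensions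
1+p > n are excluded by 1+p+q = n (H^{2(1+p)} = 0 there). (why it might fail: Equivalent to HC
(algebraic classes satisfy it with b = 0; DivisorIdealLift gives the converse): fails iff HC fails,
e.g. for a non-algebraic Weil-type class on an abelian fourfold.) [Deligne2000, VoisinHodgeI2002,
idea:HodgeConjecture/HodgeConjecture/cr-link-maximally-complex-cycles]
#2 LinkRigidity (crux) — THEOREM (T) OF THE CARD, SUPPORT FORM. SETTING (shared verbatim by
LinkCycleExistence / ContactRepresentative / GysinKernelDivisorial / LinkProjectionExists — one
generated text fragment, so the Assembly is pure logic): X ⊂ ℙ^N_ℂ smooth projective of dimension n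
via a closed immersion ι; LINK L = {v ∈ ℂ^{N+1} : Σ|v_i|² = 1, ∃ hv : v ≠ 0, projPoint N [v] ∈
range(AlgPoints.map ι)} (unit circle bundle of O_X(−1), a compact (2n+1)-manifold); projection π :
C(L, X(ℂ)) QUANTIFIED by ι(π v) = projPoint N [v] (existence = LinkProjectionExists). A MAXIMALLY
COMPLEX (2q+1)-CARRIER is a compact W ⊆ L, 𝓗^{2q+1}(W) < ∞, with a closed scar set S ⊆ W, 𝓗^{2q}(S)
= 0, such that near every x ∈ W ∖ S, W = g⁻¹(0) ∩ U for a C^1 map g : ℂ^{N+1} → ℝ^{2N+1−2q} with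
surjective differential at x whose kernel (T_xW, dimension 2q+1) contains a complex q-plane; 'π^*c
is CARRIED by W' = π^*c restricts to 0 on L ∖ W. CLAIM: 1+p+q = n, c ∈ H^{2(1+p)}(X(ℂ);ℂ) (any
complex class) carried by such W ⇒ ∃ z ∈ algebraicClasses X (1+p), π^*(c − z) = 0. SKETCH: π^*c ∈ im
H^{2(1+p)}(L, L∖W) ≅ Ȟ_{2q+1}(W) ≅ H^{BM}_{2q+1}(W∖S) (Alexander duality; dim S ≤ 2q−1 by Szpilrajn;
tails of accumulating components die by continuity of Čech homology) ⇒ π^*c = Σ_j λ_j PD[W_j],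
finitely many orientable components; each [W_j] has finite mass and flat boundary supported in S,
hence is CLOSED (Federer 4.1.20) and maximally complex of dimension ≥ 3 (q = 0 trivial: H^{2n}
algebraic) ⇒ [W_j] = dT_j, T_j a holomorphic (q+1)-chain in the ball (Harvey–Lawson 1975), supp T_j
⊂ Ĉ(X) (a.e. one-sided boundary regularity, HarveyLawson2004 §1, + boundary uniqueness for the
homogeneous ideal) ⇒ [W_j] ∼ [slice_t T_j] for t ∈ (0,1) → (t → 0, bounded mass ratio) the link of
the TANGENT CONE of T_j at the vertex, a holomorphic chain (King 1971) = cone over an algebraic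
q-cycle (Chow; tree: Motives.coneChow PROVED) ⇒ PD[W_j] ∈ π^*(algebraicClasses X (1+p)). Lean: no
currents in the tree (definition requests); the statement itself is Mathlib (hausdorffMeasure,
fderiv, ContDiffOn, restrictScalars, Projectivization) + projPoint / AlgPoints.map / complexBetti /
algebraicClasses / singularCohomology.map. [difficulty: XL] (why it might fail: supp T ⊂ cone needs
boundary uniqueness at merely C^1 one-sided boundary points with scar sets; class transport through
the vertex (slices → link of the tangent cone, with multiplicities) for multi-component chains;
carriers with infinitely many pieces accumulating on S.) [HarveyLawson1975, HarveyLawson1977,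
Harvey1977, HarveyLawson2004, King1971, Chow1949, Federer1969, BoothbyWang1958,
idea:HodgeConjecture/HodgeConjecture/cr-link-maximally-complex-cycles]
#3 ContactRepresentative (crux) — THE SOFT HALF (card K3 / STEP 1): in the setting of LinkRigidity,
for 1+p+q = n every RATIONAL class c ∈ H^{2(1+p)}(X(ℂ);ℂ) (no Hodge condition: topology should not
see the Hodge type — if it does, either way is a discovery) has π^*c carried by a compact C^1
CONTACT submanifold W ⊆ L of dimension 2q+1 without scars: near every x ∈ W, W = g⁻¹(0) ∩ U, dg_x
surjective onto ℝ^{2N+1−2q}, and T = ker dg_x satisfies (i) T ⊄ ξ_x (some w ∈ T has ⟨x,w⟩ = Σ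
conj(x_i)w_i ≠ 0; ξ_x = {w ∈ T_xL : ⟨x,w⟩ = 0} is the Boothby–Wang contact plane, η = Im⟨x,dv⟩, dη =
π^*ω_FS) and (ii) dη = Im⟨·,·⟩ non-degenerate on T ∩ ξ_x. Maximal complexity (T ∩ ξ_x a complex
q-plane) is the special case 'symplectic AND J-invariant' of (ii), so this is the formal shadow of
LinkCycleExistence; W may be disconnected or empty. WHY TRUE: existence h-principle for isocontact
embeddings of closed manifolds in codimension 2(1+p) ≥ 4 (Gromov PDR 3.4; Eliashberg–Mishachev ch.
12) and codimension 2 (Casals–Pancholi–Presas), so W exists once the FORMAL problem is solvable: an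
almost-contact (2q+1)-manifold embedded in the class N·PD(π^*c) (Thom realisability after a
multiple) with complex normal bundle ν, ξ_W ⊕ ν ≅ ξ|_W up to homotopy. USE: child of
LinkCycleExistence at the first split; first non-trivial test q ≥ 1, e.g. X = E×E×E, classes in H^4
(contact 3-folds in the 7-dimensional link); a refutation for a HODGE class is the route's negative
branch. [difficulty: L] (why it might fail: The formal datum may be obstructed: W must be
almost-contact with complex normal bundle ν such that ξ_W ⊕ ν ≅ ξ|_W (Chern-class constraints on ν
vs c|_W); Thom realisability gives embedded W only after multiples and says nothing about ν being
complex.) [Gromov1986, EliashbergMishachev2002, CasalsPancholiPresas2021, Thom1954, BoothbyWang1958,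
idea:HodgeConjecture/HodgeConjecture/cr-link-maximally-complex-cycles]
#4 LinkCycleExistence (crux) — EXISTENCE OF CR-CARRIERS (the HC-hard half): in the setting of
LinkRigidity, for 1+p+q = n every rational class c of Hodge type (1+p,1+p) has π^*c carried by a
maximally complex (2q+1)-carrier W ⊆ L (carrier predicate of LinkRigidity, verbatim). HC ⇒ this (W =
⋃_j π⁻¹(Z_j(ℂ)) for c = Σ λ_j cl(Z_j): S^1-invariant, smooth off a set of real dimension ≤ 2q−1;
cl(Z_j) restricts to 0 off Z_j by the definition of algebraicClasses as supported classes) and this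
+ LinkRigidity + GysinKernelDivisorial ⇒ HodgeModDivisorIdeal ⇒ HC, so given (T) the item is
EQUIVALENT to HC: HC as an existence problem for closed solutions of a first-order pointwise CR
condition on (2q+1)-dimensional subsets of ONE compact contact manifold, in the FIXED class π^*c,
with no positivity, no ballast a + C·h^p, no reference to h (dead on L); locally flexible (families
of complex q-discs), globally rigid. For transcendental c no carrier exists (LinkRigidity), so a
construction must use the Hodge type; extra structure on L absent on X: the free S^1 (Reeb) action —
Fourier modes of currents along fibres, Kohn–Rossi cohomology ⊕_k H^q(X, Ω^•(k)), Kodaira–Serre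
vanishing for k ≠ 0. INTENDED SPLIT (layer 2): ContactRepresentative → DefectClosing (drive the
Kähler-angle defect D(W) = ∫_W (1 − cos θ(TW ∩ ξ)) to 0 inside the contact-isotopy class at BOUNDED
volume; flat compactness + l.s.c.) → LinkCycleExistence. Trade-off to beat: Donaldson–Auroux lifts
give D/vol = O(1/k) only at vol ∼ k^p; the card's S^1-averaging lemma (K5) is a candidate lever
flagged likely FALSE (averaging destroys integrality) — a refutation target, not filed. [deps:
LinkRigidity, ContactRepresentative] [difficulty: open-problem] (why it might fail: HC-hard: with
LinkRigidity it implies HC mod divisors for X, so it fails for any counterexample to HC; and no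
mechanism lowering volume at fixed CR-defect in a fixed class of L is known (Donaldson–Auroux lifts:
defect O(1/k) only at volume ∼ k^p).) [HarveyLawson1975, HarveyLawson2009,
HarveyLawson2006RelativeHodge, BoothbyWang1958, Deligne2000,
idea:HodgeConjecture/HodgeConjecture/cr-link-maximally-complex-cycles]
#9 HodgeModels (support) — THE SUMMIT'S ANTI-VACUITY CONJUNCT, shared by every route on this summit
(same signature as item stmt-HodgeConjecture-1943 of route AnchorTransport, so this block ATTACHES
to it): every smooth projective X/ℂ of dimension n has a Hodge model (analytification, natural
complex de Rham comparison, Hodge decomposition). Verbatim the Literature named fact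
HodgeTheory.nonempty_hodgeModel (Serre GAGA §2; de Rham; Hodge), GENUINELY needed: it is conjunct 1
of HodgeConjectureFor, i.e. part of the summit statement itself; filed as an item so that the debt
is named in the ledger (tier-0 debt of the summit) and the Assembly stays pure logic. Closes by `fun
n X => nonempty_hodgeModel_holds` once the fact is discharged (reduction in tree:
HodgeModelExistenceDischarge.nonempty_hodgeModel_of_deRham_of_hodgeDecomposition; remaining leaves:
the real de Rham theorem and the Hodge decomposition facts). [difficulty: M] [SerreGAGA1956,
VoisinHodgeI2002]
#9 LinkProjectionExists (support) — CONSTRUCTION STATEMENT FOR THE POSITED INTERFACE π (the cruxes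
quantify over π with its defining property; existence is proved here, never assumed): for every
closed immersion ι : X → ℙ^N_ℂ and the link L = {v ∈ ℂ^{N+1} : Σ|v_i|² = 1, ∃ hv, projPoint N [v] ∈
range(AlgPoints.map ι)} there is a continuous π : L → X(ℂ) with AlgPoints.map ι (π v) = projPoint N
[v]. Proof: AlgPoints.map ι is a topological embedding for a closed immersion (tree:
Motives.AlgPoints.isEmbedding_map_of_isClosedImmersion in HodgeTheory/HypersurfaceComplexPoints)
hence a homeomorphism onto its range; projPoint N is a homeomorphism
(Transcendental.isHomeomorph_projPoint); v ↦ Projectivization.mk ℂ v _ is continuous on {v ≠ 0}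
(Projectivization.continuous_mk'); every v ∈ L lands in the range by definition of L. Routine, ≈ 50
lines (cf. HodgeTheory.hypersurfacePoint for the same inversion). [difficulty: provable-now]
[SerreGAGA1956, idea:HodgeConjecture/HodgeConjecture/cr-link-maximally-complex-cycles]
#9 GysinKernelDivisorial (support) — THE HYPERPLANE CLASS DIES ON THE LINK, AND NOTHING ELSE (card
Corollary H, Gysin bookkeeping): in the setting of LinkRigidity, if c' ∈ H^{2(1+p)}(X(ℂ);ℂ) has
π^*c' = 0 in H^{2(1+p)}(L;ℂ) then c' = d ∪ b for some d ∈ algebraicClasses X 1 and b ∈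
H^{2p}(X(ℂ);ℂ). Proof: π : L → X(ℂ) is the unit circle bundle of O_X(−1) (restriction of the Hopf
fibration S^{2N+1} → ℙ^N(ℂ)); its Gysin sequence H^{2p}(X) —(∪e)→ H^{2(1+p)}(X) —π^*→ H^{2(1+p)}(L)
gives ker π^* = e ∪ H^{2p}(X) with Euler class e = c_1(O(−1)) = −h, and h = cl(X ∩ H) ∈
algebraicClasses X 1 = N^1H^2 (h vanishes on X ∖ H, where O(1) is trivial; points of X ∩ H have
coheight ≥ 1); take d = h (graded commutativity in even degrees if the sequence comes as b ∪ e).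
Known (Bott–Tu §14, Hatcher §4.D, Milnor–Stasheff §12); Lean-heavy: needs the Gysin / Thom sequence
of this concrete circle bundle in the tree's singular cohomology and e = hyperplane class (tree:
LefschetzOneOneChernWeil*, ChernClasses). [difficulty: L] [BoothbyWang1958, Hatcher2002,
idea:HodgeConjecture/HodgeConjecture/cr-link-maximally-complex-cycles]
#9 DivisorIdealLift (support) — X → SUMMIT (card Corollary H): HodgeModels → HodgeModDivisorIdeal →
HodgeConjecture. Proof: model conjunct = HodgeModels; choose ι : X → ℙ^N from IsProjectiveOver;
cycle part by induction on the codimension k: k = 0 is algebraicClasses_zero, 2k > 2n is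
subsingleton_complexBetti; for 1 ≤ k = 1+p ≤ n, c rational of type (k,k): HodgeModDivisorIdeal gives
c = z + d ∪ b. RATIONALITY DESCENT: A^k := algebraicClasses X k and A^1 ∪ H^{2p} are ℂ-spans of
ℚ-subspaces (kernels of restriction maps are defined over ℚ; A^1_ℚ = ℚ-span of divisor classes by
purity in codimension 1) and (V_ℚ ⊗ ℂ) ∩ H_ℚ = V_ℚ, so c = z' + Σ_i cl(D_i) ∪ b_i with z' ∈ A^k_ℚ,
b_i rational. HODGE LIFT: (b_i) ↦ Σ cl(D_i) ∪ b_i is a morphism of polarisable ℚ-Hodge structures; c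
− z' is a rational Hodge class in its image (algebraic ⇒ type (k,k), Voisin I 11.20), so by
semisimplicity it has a HODGE preimage (b_i'); induction gives b_i' ∈ A^p; divisor ∪ algebraic is
algebraic (tree: cupProduct_mem_algebraicClasses_of_moving, l = 1, moving discharged by D ∼ H_1 −
H_2 with H_i very ample moved off the support); hence c ∈ A^k. Known, Lean-heavy: needs 'supported
classes are Hodge' (tree: SupportedClassesHodgeConiveau*) and polarisation/semisimplicity
(HodgeStructure*, KaehlerTopologyHardLefschetz*), today partly named facts. [difficulty: L]
[VoisinHodgeI2002, VoisinHodgeII2003, Deligne2000,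
idea:HodgeConjecture/HodgeConjecture/cr-link-maximally-complex-cycles]

TWO-LAYER PLAN. Foreseen, filed only when a crux moves (k ≤ 3, depth 1): LinkCycleExistence ⇐
ContactRepresentative → DefectClosing → LinkCycleExistence, where
DefectClosing = "for a Hodge class, inf{𝓗^{2q+1}(W) : W a compact contact carrier of π^*c with
Kähler-angle defect D(W) ≤ ε·𝓗^{2q+1}(W)} stays bounded
as ε → 0" (flat compactness + lower semicontinuity of D then produce a maximally complex limit
carrier); LinkRigidity ⇐ FillingInCone (HL filling +
supp T ⊂ Ĉ(X)) → VertexTransport (class of the boundary = class of the link of the tangent cone) →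
LinkRigidity; ContactRepresentative ⇐ FormalDatum
(almost-contact W with complex normal bundle in the class) → IsocontactHPrinciple →
ContactRepresentative.

KILL CRITERIA. (i) LinkRigidity refuted — a maximally complex carrier of a class that is not
algebraic mod ker π^*, e.g. a holomorphic chain in the cone whose boundary
class differs from the class of its tangent cone's link — closes the route outright (`close --reason
refuted:LinkRigidity`): the reformulation is dead.
(ii) ContactRepresentative refuted by a TRANSCENDENTAL class: restate it for Hodge classes only (1:1
repair); refuted by a HODGE class: the formal
obstruction is a theorem against existence on L and the route pivots to the negative side (hand the
witness to the refuters as a candidate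
obstruction to algebraicity). (iii) LinkCycleExistence has no kill short of ¬HC; if after
LinkRigidity lands every volume-lowering mechanism at fixed
defect is refuted (averaging lemma false AND no replacement), close `exhausted` with census and
promote (T) + GysinKernelDivisorial + DivisorIdealLift
as the reformulation theorem. HC proved elsewhere moots everything; HodgeModDivisorIdeal proved
elsewhere moots the link layer.

NOT DECOMPOSED YET. Deliberately not filed at open: the defect functional D(W) = ∫_W (1 − cos θ(TW ∩
ξ)) and the volume bound at vanishing defect (card K4 — the child
DefectClosing above); the S^1-averaging / Kohn–Rossi lemma (card K5, likely false: averaging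
destroys integrality — a refutation target); integral
currents, holomorphic chains, tangent cones of chains as Lean notions (definition requests below,
wanted when LinkRigidity is first claimed); the
formal-homotopy clause of the isocontact h-principle (ContactRepresentative is typed without it);
integral (not rational) refinements (Kollár-type
predictions); the worked example E × E (informal support item EllipticSquareCalibration, filed after
open). Import-cone note for tenure: the statements
need projPoint (Transcendental.AnalytificationProjProofs), whose cone adds Motives/BaseChange.lean
with two not-yet-discharged facts
(isHomeomorph_baseChangeEquiv, finite_pointsOver) to the summit's base cone.

CHEAPEST FALSIFIER. Two cheap checks, refuters first: (a) LITERATURE: is Theorem T (classes of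
H^{2(1+p)} of the link of a cone carried by closed maximally complex
cycles = π^* of algebraic classes) already in print in the Harvey–Lawson / Dolbeault–Henkin boundary
literature (HarveyLawson1975/1977, Harvey1977,
DolbeaultHenkin1997, HarveyLawson2004/2010)? I searched (Novelty) and read HarveyLawson2004 §§1–2:
the boundary problem is always posed inside ℂⁿ or
ℙⁿ minus a linear subspace, never on the link — not found, but Harvey1977 (PSPUM XXX) could not be
opened (galaxyd saturated; acq-02130 filed for
HarveyLawson1975). (b) BY HAND (item EllipticSquareCalibration): X = E × E ⊂ ℙ^8 (Segre of two plane
cubics), q = 1: compute H_3 of the 5-dimensional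
link, τ of the graph classes of isogenies versus the two transcendental classes, and check that (T)
+ Gysin reproduce exactly NS(E×E) ⊗ ℚ; any
mismatch kills LinkRigidity or GysinKernelDivisorial as typed.

NUMBERS. dim_ℝ L = 2n+1; carriers have dimension 2q+1 = 2n+1 − 2(1+p) and must contain a complex
q-plane at every manifold point; h-principle range:
codimension 2(1+p) ≥ 4 for p ≥ 1 (Gromov1986 §3.4), codimension 2 for p = 0
(CasalsPancholiPresas2021); HL boundary theorem needs 2q+1 ≥ 3
(no moment condition), q = 0 is the trivial top-degree case. Items at open: 9 (1 target, 3 cruxes, 4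
support, 1 assembly); one informal support
item and two definition requests follow.

DEFINITION REQUESTS. After open (against LinkRigidity): `IntegralCurrent` / `currentOfIntegration`
(integer-rectifiable currents in a finite-dimensional real normed
space, boundary, mass, flat norm; Federer 4.1) and `HolomorphicChain` (locally finite ℤ-combination
of irreducible analytic subsets of pure
dimension, as a current; King1971) under Literature/Geometry (topic GeometricMeasureTheory), plus
the cite fact 'maximally complex closed
rectifiable (2q+1)-currents with compact support in ℂⁿ, q ≥ 1, bound holomorphic (q+1)-chains'
(HarveyLawson1975 main theorem; HarveyLawson2004
Thm .4). None is needed to STATE the items (they are typed with Mathlib's hausdorffMeasure / fderiv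
/ Submodule.restrictScalars).

Novelty: Searches (2026-08-15): `lit search --hybrid "maximally complex cycles Sasakian circle bundle link of
affine cone algebraic cycles Hodge conjecture"` (12 rows: Voisin I/II, Green–Murre–Voisin,
Carlson–Müller-Stach–Peters, Cattani et al. — no link/CR statement); `lit galaxy search "maximally
complex submanifold" --star all` (4 rows: Chirka–Dolbeault–Khenkin–Vitushkin, PSPUM XXX =
Harvey1977, Della Sala's thesis on non-compact CR manifolds, Krantz — none touches Hodge classes);
`lit read arXiv:math/0512490` = HarveyLawson2004 (READ §§1–2: boundaries inside ℂⁿ / ℙⁿ minus a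
linear subspace, moment conditions, projective linking; never the link of a cone, never a
cohomology-class characterisation); crossref look-ups for HarveyLawson1975, HarveyLawson1977,
Harvey1977, King1971, DolbeaultHenkin1997, HarveyLawson2009 (arXiv:0710.3921 §6: 'Hodge questions'
for φ-cycles with ballast IN X), HarveyLawson2006RelativeHodge (arXiv:math/0610533: the RELATIVE
Hodge question in X with a positive (p,p)-current remainder), HarveyLawson2010; `lit frontier
HodgeConjecture --since 2020` (30 rows, none GMT/CR); the card's audited searches (arXiv/zbMATH
'maximally complex … Hodge', 'Sasakian circle bundle CR submanifolds Hodge conjecture', 'boundaries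
of holomorphic chains', 'isocontact embedding h-principle CR': nothing relevant); `ledger negatives
--problem HodgeConjecture` (empty).
Nearest prior art found: HarveyLawson1975 (the boundary theorem itself, in Stein manifolds) and
Harvey–Lawson's own GM  [refs: math/0512490, 0710.3921, math/0610533, Harvey1977, HarveyLawson2004, HarveyLawson1975, HarveyLawson1977, King1971, DolbeaultHenkin1997, HarveyLawson2009, HarveyLawson2010, Gromov1986, CasalsPancholiPresas2021]

Barriers (technique_class: cr-geometry, contact-topology, complex-analytic, gmt): - technique_class: cr-geometry, contact-topology, complex-analytic, gmt
- Literature.Barriers.HodgeConjecture.Zucker1977_kaehlerTorus_noAnalyticCycles: evaded — the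
construction needs X ⊂ ℙ^{N+1}: the affine cone, its Stein filling by the ball, and Chow's theorem
for the tangent cone at the vertex (tree: Motives.coneChow); none of this exists for a
non-projective Kähler torus, so the argument does not 'apply verbatim to compact Kähler manifolds' —
projectivity is used essentially, consistent with the barrier.
- Literature.Barriers.HodgeConjecture.Voisin2002_weilTorus_hodgeClassWithoutSubvarieties: evaded for
the same reason, and no Chern classes of coherent sheaves / holomorphic bundles are used: the cycle
is produced as the tangent cone of a holomorphic chain filling a CR-cycle of the link, an object
that requires the cone over a projective embedding.
- Literature.Barriers.HodgeConjecture.AtiyahHirzebruch1962_torsionClass_notAlgebraic and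
Literature.Barriers.HodgeConjecture.Kollar1992_nonTorsionClass_notAlgebraic: respected — every
statement is with ℂ-coefficients ('carried by W' = the pulled-back class restricts to 0 off W,
insensitive to multiples), the target is rational HC; integrally Theorem T predicts that Kollár's
class gives a 3-dimensional homology class of the link of a threefold cone containing no closed
maximally complex INTEGRAL cycle although a multiple does — a prediction, not a conflict.
- Literature.Barriers.HodgeConjecture.Voisin2003_generalHypersurface_noI

sub-problem: HodgeConjecture · status: done · opened planner-plancard-HodgeConjecture-HodgeConject-6c527646-0 2026-08-15T11:17:03Z · rev 1 · ledger route-HodgeConjecture-CrLinkCycles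
GENERATED by the gate from the ledger (D-0016/17). Provers cite these decls: `theorem foo : Summit.HodgeConjecture.HodgeConjecture.Theses.CrLinkCycles.<Decl> := …` in Summits/HodgeConjecture/HodgeConjecture/Theorems/<Name>.lean.
-/

namespace Summit.HodgeConjecture.HodgeConjecture.Theses.CrLinkCycles

open scoped BigOperators Topology Manifold Classical MeasureTheory ProbabilityTheory Matrix InnerProductSpace ComplexConjugate ContinuousMap
open Filter Set Function TopologicalSpace MeasureTheory

attribute [summit_statement] _root_.HodgeConjecture

/-- item stmt-HodgeConjecture-3349 · target · rank 0 · open · by planner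
why it might fail: Equivalent to rational HC (algebraic classes satisfy it with b = 0; DivisorIdealLift gives the converse by induction on codimension and Hodge-structure semisimplicity): fails iff HC fails, e.g. for a non-algebraic Weil-type class on an abelian fourfold (Weil1977, none known).
sources: Deligne2000, VoisinHodgeI2002, Weil1977, idea:HodgeConjecture/HodgeConjecture/cr-link-maximally-complex-cycles
[target] HODGE MODULO THE DIVISOR IDEAL (X of § Thesis): for X smooth projective of dimension n,
1+p+q = n, every rational class c ∈ H^{2(1+p)}(X(ℂ);ℂ) of Hodge type (1+p,1+p) is z + d ∪ b with z ∈
algebraicClasses X (1+p), d ∈ algebraicClasses X 1, b ∈ H^{2p}(X(ℂ);ℂ) arbitrary (ℂ-coefficients;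
single-product form = what the Gysin kernel gives with d = h). Delivered by LinkProjectionExists +
LinkCycleExistence + LinkRigidity + GysinKernelDivisorial (pure logic, theorem glue_check of the
planner sketch); implies HC by DivisorIdealLift. Codimensions 1+p > n are excluded by 1+p+q = n
(H^{2(1+p)} = 0 there). -/
@[route_item "route-HodgeConjecture-CrLinkCycles"]
def HodgeModDivisorIdeal : Prop :=
  ∀ (n : ℕ) (X : Literature.AlgebraicGeometry.Motives.SchemeOver ℂ), Literature.AlgebraicGeometry.Motives.IsSmoothProjective n X → ∀ (p q : ℕ), 1 + p + q = n → ∀ c : Literature.AlgebraicGeometry.HodgeTheory.complexBetti X (2 * (1 + p)), Literature.AlgebraicGeometry.HodgeTheory.IsRationalClass c → Literature.AlgebraicGeometry.HodgeTheory.IsOfHodgeType n X (2 * (1 + p)) (1 + p) (1 + p) c → ∃ z ∈ Literature.AlgebraicGeometry.HodgeTheory.algebraicClasses X (1 + p), ∃ d ∈ Literature.AlgebraicGeometry.HodgeTheory.algebraicClasses X 1, ∃ b : Literature.AlgebraicGeometry.HodgeTheory.complexBetti X (2 * p), c = z + Literature.AlgebraicTopology.SingularHomology.cupProduct (Nat.mul_add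 2 1 p).symm d b

/-- item stmt-HodgeConjecture-3350 · crux · rank 2 · open · by planner
why it might fail: Unpublished for cones; three GMT inputs at mere C^1 regularity: d[W_j]=0 only because H^{2q}(S)=0 (flat chains on H^{2q}-null sets vanish, Federer 4.1.20) before HL1975 applies; supp T ⊂ Ĉ(X) by a.e. boundary regularity+uniqueness (HL2004 §1); vertex transport (strict transform ∩ zero section).
sources: HarveyLawson1975, HarveyLawson1977, Harvey1977, HarveyLawson2004, King1971, Chow1949
[crux] THEOREM (T) OF THE CARD, SUPPORT FORM. SETTING (shared verbatim by LinkCycleExistence /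
ContactRepresentative / GysinKernelDivisorial / LinkProjectionExists — one generated text fragment,
so the Assembly is pure logic): X ⊂ ℙ^N_ℂ smooth projective of dimension n via a closed immersion ι;
LINK L = {v ∈ ℂ^{N+1} : Σ|v_i|² = 1, ∃ hv : v ≠ 0, projPoint N [v] ∈ range(AlgPoints.map ι)} (unit
circle bundle of O_X(−1), a compact (2n+1)-manifold); projection π : C(L, X(ℂ)) QUANTIFIED by ι(π v)
= projPoint N [v] (existence = LinkProjectionExists). A MAXIMALLY COMPLEX (2q+1)-CARRIER is a
compact W ⊆ L, 𝓗^{2q+1}(W) < ∞, with a closed scar set S ⊆ W, 𝓗^{2q}(S) = 0, such that near every x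
∈ W ∖ S, W = g⁻¹(0) ∩ U for a C^1 map g : ℂ^{N+1} → ℝ^{2N+1−2q} with surjective differential at x
whose kernel (T_xW, dimension 2q+1) contains a complex q-plane; 'π^*c is CARRIED by W' = π^*c
restricts to 0 on L ∖ W. CLAIM: 1+p+q = n, c ∈ H^{2(1+p)}(X(ℂ);ℂ) (any complex class) carried by
such W ⇒ ∃ z ∈ algebraicClasses X (1+p), π^*(c − z) = 0. SKETCH: π^*c ∈ im H^{2(1+p)}(L, L∖W) ≅
Ȟ_{2q+1}(W) ≅ H^{BM}_{2q+1}(W∖S) (Alexander duality; dim S ≤ 2q−1 by Szpilrajn; tails of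
accumulating components die by conti -/
@[route_item "route-HodgeConjecture-CrLinkCycles"]
def LinkRigidity : Prop :=
  ∀ (N n : ℕ) (X : Literature.AlgebraicGeometry.Motives.SchemeOver ℂ), Literature.AlgebraicGeometry.Motives.IsSmoothProjective n X → ∀ (ι : X ⟶ Literature.AlgebraicGeometry.Motives.projectiveSpace N ℂ) [AlgebraicGeometry.IsClosedImmersion ι.left] (L : Set (Fin (N + 1) → ℂ)), (∀ v : (Fin (N + 1) → ℂ), v ∈ L ↔ (∑ i, ‖v i‖ ^ 2 = 1 ∧ ∃ hv : v ≠ 0, Literature.NumberTheory.Transcendental.projPoint N (Projectivization.mk ℂ v hv) ∈ Set.range (Literature.AlgebraicGeometry.Motives.AlgPoints.map ι))) → ∀ (π : C(L, Literature.AlgebraicGeometry.Motives.ComplexPoints X)), (∀ (v : L) (hv : (v : (Fin (N + 1) → ℂ)) ≠ 0), Literature.AlgebraicGeometry.Motives.AlgPoints.map ι (π v) = Literature.NumberTheory.Transcendental.projPoint N (Projectivization.mk ℂ (v : (Fin (N + 1) → ℂ)) hv)) → ∀ (p q : ℕ), 1 + p + q = n → ∀ (c : Literature.AlgebraicGeometry.HodgeTheory.complexBetti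 X (2 * (1 + p))) (W : Set (Fin (N + 1) → ℂ)), (IsCompact W ∧ W ⊆ L ∧ MeasureTheory.Measure.hausdorffMeasure (2 * (q : ℝ) + 1) W < ⊤ ∧ ∃ S ⊆ W, IsClosed S ∧ MeasureTheory.Measure.hausdorffMeasure (2 * (q : ℝ)) S = 0 ∧ ∀ x ∈ W \ S, ∃ U ∈ 𝓝 x, ∃ g : (Fin (N + 1) → ℂ) → (Fin (2 * N + 1 - 2 * q) → ℝ), ContDiffOn ℝ 1 g U ∧ Function.Surjective (fderiv ℝ g x) ∧ W ∩ U = {y | y ∈ U ∧ g y = 0} ∧ ∃ P : Submodule ℂ (Fin (N + 1) → ℂ), Module.finrank ℂ P = q ∧ Submodule.restrictScalars ℝ P ≤ LinearMap.ker (fderiv ℝ g x).toLinearMap) → Literature.AlgebraicTopology.SingularHomology.singularCohomology.map ℂ ℂ (⟨Set.inclusion Set.sdiff_subset, continuous_inclusion Set.sdiff_subset⟩ : C(↥(L \ W), L)) (2 * (1 + p)) (Literature.AlgebraicTopology.SingularHomology.singularCohomology.map ℂ ℂ π (2 * (1 + p)) c) = 0 → ∃ z ∈ Literature.AlgebraicGeometry.HodgeTheory.algebraicClasses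 X (1 + p), Literature.AlgebraicTopology.SingularHomology.singularCohomology.map ℂ ℂ π (2 * (1 + p)) (c - z) = 0

/-- item stmt-HodgeConjecture-3351 · crux · rank 3 · open · by planner
why it might fail: Gromov1986 (codim ≥ 4) + CasalsPancholiPresas2021 Thm 2 (codim 2, dim L ≥ 5) reduce it to a FORMAL problem, possibly obstructed for q ≥ 2: N·PD(π^*c) must be realised (Thom) by an almost-contact W^{2q+1} (W_3=0 if q=2) with df homotopic to a ξ-complex monomorphism; clear only for q ≤ 1, codim ≥ 4.
sources: Gromov1986, EliashbergMishachev2002, CasalsPancholiPresas2021, arXiv:2211.03713, Thom1954, BoothbyWang1958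
[crux] THE SOFT HALF (card K3 / STEP 1): in the setting of LinkRigidity, for 1+p+q = n every
RATIONAL class c ∈ H^{2(1+p)}(X(ℂ);ℂ) (no Hodge condition: topology should not see the Hodge type —
if it does, either way is a discovery) has π^*c carried by a compact C^1 CONTACT submanifold W ⊆ L
of dimension 2q+1 without scars: near every x ∈ W, W = g⁻¹(0) ∩ U, dg_x surjective onto ℝ^{2N+1−2q},
and T = ker dg_x satisfies (i) T ⊄ ξ_x (some w ∈ T has ⟨x,w⟩ = Σ conj(x_i)w_i ≠ 0; ξ_x = {w ∈ T_xL :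
⟨x,w⟩ = 0} is the Boothby–Wang contact plane, η = Im⟨x,dv⟩, dη = π^*ω_FS) and (ii) dη = Im⟨·,·⟩
non-degenerate on T ∩ ξ_x. Maximal complexity (T ∩ ξ_x a complex q-plane) is the special case
'symplectic AND J-invariant' of (ii), so this is the formal shadow of LinkCycleExistence; W may be
disconnected or empty. WHY TRUE: existence h-principle for isocontact embeddings of closed manifolds
in codimension 2(1+p) ≥ 4 (Gromov PDR 3.4; Eliashberg–Mishachev ch. 12) and codimension 2
(Casals–Pancholi–Presas), so W exists once the FORMAL problem is solvable: an almost-contact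
(2q+1)-manifold embedded in the class N·PD(π^*c) (Thom realisability after a multiple) with complex
normal bundle ν, ξ_W ⊕ ν ≅ ξ|_W u -/
@[route_item "route-HodgeConjecture-CrLinkCycles"]
def ContactRepresentative : Prop :=
  ∀ (N n : ℕ) (X : Literature.AlgebraicGeometry.Motives.SchemeOver ℂ), Literature.AlgebraicGeometry.Motives.IsSmoothProjective n X → ∀ (ι : X ⟶ Literature.AlgebraicGeometry.Motives.projectiveSpace N ℂ) [AlgebraicGeometry.IsClosedImmersion ι.left] (L : Set (Fin (N + 1) → ℂ)), (∀ v : (Fin (N + 1) → ℂ), v ∈ L ↔ (∑ i, ‖v i‖ ^ 2 = 1 ∧ ∃ hv : v ≠ 0, Literature.NumberTheory.Transcendental.projPoint N (Projectivization.mk ℂ v hv) ∈ Set.range (Literature.AlgebraicGeometry.Motives.AlgPoints.map ι))) → ∀ (π : C(L, Literature.AlgebraicGeometry.Motives.ComplexPoints X)), (∀ (v : L) (hv : (v : (Fin (N + 1) → ℂ)) ≠ 0), Literature.AlgebraicGeometry.Motives.AlgPoints.map ι (π v) = Literature.NumberTheory.Transcendental.projPoint N (Projectivization.mk ℂ (v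 : (Fin (N + 1) → ℂ)) hv)) → ∀ (p q : ℕ), 1 + p + q = n → ∀ c : Literature.AlgebraicGeometry.HodgeTheory.complexBetti X (2 * (1 + p)), Literature.AlgebraicGeometry.HodgeTheory.IsRationalClass c → ∃ W : Set (Fin (N + 1) → ℂ), (IsCompact W ∧ W ⊆ L ∧ ∀ x ∈ W, ∃ U ∈ 𝓝 x, ∃ g : (Fin (N + 1) → ℂ) → (Fin (2 * N + 1 - 2 * q) → ℝ), ContDiffOn ℝ 1 g U ∧ Function.Surjective (fderiv ℝ g x) ∧ W ∩ U = {y | y ∈ U ∧ g y = 0} ∧ (∃ w ∈ LinearMap.ker (fderiv ℝ g x).toLinearMap, (∑ i, (starRingEnd ℂ) (x i) * w i) ≠ 0) ∧ ∀ w ∈ LinearMap.ker (fderiv ℝ g x).toLinearMap, (∑ i, (starRingEnd ℂ) (x i) * w i) = 0 → (∀ w' ∈ LinearMap.ker (fderiv ℝ g x).toLinearMap, (∑ i, (starRingEnd ℂ) (x i) * w' i) = 0 → (∑ i, (starRingEnd ℂ) (w i) * w' i).im = 0) → w = 0) ∧ Literature.AlgebraicTopology.SingularHomology.singularCohomology.map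 ℂ ℂ (⟨Set.inclusion Set.sdiff_subset, continuous_inclusion Set.sdiff_subset⟩ : C(↥(L \ W), L)) (2 * (1 + p)) (Literature.AlgebraicTopology.SingularHomology.singularCohomology.map ℂ ℂ π (2 * (1 + p)) c) = 0

/-- item stmt-HodgeConjecture-3352 · crux · rank 4 · open · by planner
why it might fail: HC-hard: with LinkRigidity + Gysin it gives HodgeModDivisorIdeal, so it fails for any counterexample to rational HC (e.g. a non-algebraic Weil class on an abelian fourfold); no mechanism lowering volume at fixed CR-defect in a fixed class is known (Donaldson–Auroux: defect O(1/k), vol ~k^p).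
sources: HarveyLawson1975, HarveyLawson2009, HarveyLawson2006RelativeHodge, BoothbyWang1958, Deligne2000, idea:HodgeConjecture/HodgeConjecture/cr-link-maximally-complex-cycles
[crux] EXISTENCE OF CR-CARRIERS (the HC-hard half): in the setting of LinkRigidity, for 1+p+q = n
every rational class c of Hodge type (1+p,1+p) has π^*c carried by a maximally complex
(2q+1)-carrier W ⊆ L (carrier predicate of LinkRigidity, verbatim). HC ⇒ this (W = ⋃_j π⁻¹(Z_j(ℂ))
for c = Σ λ_j cl(Z_j): S^1-invariant, smooth off a set of real dimension ≤ 2q−1; cl(Z_j) restricts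
to 0 off Z_j by the definition of algebraicClasses as supported classes) and this + LinkRigidity +
GysinKernelDivisorial ⇒ HodgeModDivisorIdeal ⇒ HC, so given (T) the item is EQUIVALENT to HC: HC as
an existence problem for closed solutions of a first-order pointwise CR condition on
(2q+1)-dimensional subsets of ONE compact contact manifold, in the FIXED class π^*c, with no
positivity, no ballast a + C·h^p, no reference to h (dead on L); locally flexible (families of
complex q-discs), globally rigid. For transcendental c no carrier exists (LinkRigidity), so a
construction must use the Hodge type; extra structure on L absent on X: the free S^1 (Reeb) action —
Fourier modes of currents along fibres, Kohn–Rossi cohomology ⊕_k H^q(X, Ω^•(k)), Kodaira–Serre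
vanishing for k ≠ 0. INTENDED SPLIT (layer 2): Contact -/
@[route_item "route-HodgeConjecture-CrLinkCycles"]
def LinkCycleExistence : Prop :=
  ∀ (N n : ℕ) (X : Literature.AlgebraicGeometry.Motives.SchemeOver ℂ), Literature.AlgebraicGeometry.Motives.IsSmoothProjective n X → ∀ (ι : X ⟶ Literature.AlgebraicGeometry.Motives.projectiveSpace N ℂ) [AlgebraicGeometry.IsClosedImmersion ι.left] (L : Set (Fin (N + 1) → ℂ)), (∀ v : (Fin (N + 1) → ℂ), v ∈ L ↔ (∑ i, ‖v i‖ ^ 2 = 1 ∧ ∃ hv : v ≠ 0, Literature.NumberTheory.Transcendental.projPoint N (Projectivization.mk ℂ v hv) ∈ Set.range (Literature.AlgebraicGeometry.Motives.AlgPoints.map ι))) → ∀ (π : C(L, Literature.AlgebraicGeometry.Motives.ComplexPoints X)), (∀ (v : L) (hv : (v : (Fin (N + 1) → ℂ)) ≠ 0), Literature.AlgebraicGeometry.Motives.AlgPoints.map ι (π v) = Literature.NumberTheory.Transcendental.projPoint N (Projectivization.mk ℂ (v : (Fin (N + 1) → ℂ)) hv)) → ∀ (p q : ℕ), 1 + p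 + q = n → ∀ c : Literature.AlgebraicGeometry.HodgeTheory.complexBetti X (2 * (1 + p)), Literature.AlgebraicGeometry.HodgeTheory.IsRationalClass c → Literature.AlgebraicGeometry.HodgeTheory.IsOfHodgeType n X (2 * (1 + p)) (1 + p) (1 + p) c → ∃ W : Set (Fin (N + 1) → ℂ), (IsCompact W ∧ W ⊆ L ∧ MeasureTheory.Measure.hausdorffMeasure (2 * (q : ℝ) + 1) W < ⊤ ∧ ∃ S ⊆ W, IsClosed S ∧ MeasureTheory.Measure.hausdorffMeasure (2 * (q : ℝ)) S = 0 ∧ ∀ x ∈ W \ S, ∃ U ∈ 𝓝 x, ∃ g : (Fin (N + 1) → ℂ) → (Fin (2 * N + 1 - 2 * q) → ℝ), ContDiffOn ℝ 1 g U ∧ Function.Surjective (fderiv ℝ g x) ∧ W ∩ U = {y | y ∈ U ∧ g y = 0} ∧ ∃ P : Submodule ℂ (Fin (N + 1) → ℂ), Module.finrank ℂ P = q ∧ Submodule.restrictScalars ℝ P ≤ LinearMap.ker (fderiv ℝ g x).toLinearMap) ∧ Literature.AlgebraicTopology.SingularHomology.singularCohomology.map ℂ ℂ (⟨Set.inclusion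 Set.sdiff_subset, continuous_inclusion Set.sdiff_subset⟩ : C(↥(L \ W), L)) (2 * (1 + p)) (Literature.AlgebraicTopology.SingularHomology.singularCohomology.map ℂ ℂ π (2 * (1 + p)) c) = 0

/-- item stmt-HodgeConjecture-1943 · support · rank 9 · closed · proved by Summit.HodgeConjecture.HodgeConjecture.Theorems.nodalSupport_hodgeModels_proof @ 6468568b8792 (prover) · by planner
sources: SerreGAGA1956, VoisinHodgeI2002
[support] needs-fact: Literature.AlgebraicGeometry.HodgeTheory.nonempty_hodgeModel (route-repair,
cone guardrail 2026-08-15). GENUINELY needed: `Nonempty (HodgeModel n X)` is conjunct 1 of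
HodgeTheory.HodgeConjectureFor, i.e. part of the summit statement itself, so every route to
HodgeConjecture must produce it. This decl is VERBATIM the first antecedent of this route's Assembly
(and of NodalSupport's and QbarEnvelope's — re-ask this exact signature there to share the item); it
is filed as an item so that the closing chain is items-only (`Assembly_holds HodgeModels_holds
IsoInvariance_holds VariationalHodge_holds AnchorExistence_holds : HodgeConjecture` typechecks with
no unfolding; planner Sketch.lean rc 0, where `HodgeModels ↔ ∀ n X, IsSmoothProjective n X →
Nonempty (HodgeModel n X)` is Iff.rfl) and so that the fact is named in the ledger as tier-0 debt of
the summit. HOW IT CLOSES: one line, `fun n X => nonempty_hodgeModel_holds`, once the Literature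
fact is discharged — the reduction is already in tree:
HodgeModelExistenceDischarge.nonempty_hodgeModel_of_deRham_of_hodgeDecomposition (remaining leaves:
the real de Rham theorem exists_deRhamIsoFamily and the Hodge decomposition -/
@[route_item "route-HodgeConjecture-CrLinkCycles"]
def HodgeModels : Prop :=
  ∀ (n : ℕ) (X : Literature.AlgebraicGeometry.Motives.SchemeOver ℂ), Literature.AlgebraicGeometry.HodgeTheory.nonempty_hodgeModel n X

/-- `HodgeModels` holds: proved by `Summit.HodgeConjecture.HodgeConjecture.Theorems.nodalSupport_hodgeModels_proof` @ 6468568b8792. -/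
theorem HodgeModels_holds : HodgeModels := _root_.Summit.HodgeConjecture.HodgeConjecture.Theorems.nodalSupport_hodgeModels_proof

/-- item stmt-HodgeConjecture-3353 · support · rank 9 · closed · proved by Summit.HodgeConjecture.HodgeConjecture.Theorems.crLinkCycles_linkProjectionExists_proof @ eec2fc59aa12 (prover) · by planner
sources: SerreGAGA1956, idea:HodgeConjecture/HodgeConjecture/cr-link-maximally-complex-cycles
[support] CONSTRUCTION STATEMENT FOR THE POSITED INTERFACE π (the cruxes quantify over π with its
defining property; existence is proved here, never assumed): for every closed immersion ι : X →
ℙ^N_ℂ and the link L = {v ∈ ℂ^{N+1} : Σ|v_i|² = 1, ∃ hv, projPoint N [v] ∈ range(AlgPoints.map ι)}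
there is a continuous π : L → X(ℂ) with AlgPoints.map ι (π v) = projPoint N [v]. Proof:
AlgPoints.map ι is a topological embedding for a closed immersion (tree:
Motives.AlgPoints.isEmbedding_map_of_isClosedImmersion in HodgeTheory/HypersurfaceComplexPoints)
hence a homeomorphism onto its range; projPoint N is a homeomorphism
(Transcendental.isHomeomorph_projPoint); v ↦ Projectivization.mk ℂ v _ is continuous on {v ≠ 0}
(Projectivization.continuous_mk'); every v ∈ L lands in the range by definition of L. Routine, ≈ 50
lines (cf. HodgeTheory.hypersurfacePoint for the same inversion). [difficulty: provable-now] -/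
@[route_item "route-HodgeConjecture-CrLinkCycles"]
def LinkProjectionExists : Prop :=
  ∀ (N n : ℕ) (X : Literature.AlgebraicGeometry.Motives.SchemeOver ℂ), Literature.AlgebraicGeometry.Motives.IsSmoothProjective n X → ∀ (ι : X ⟶ Literature.AlgebraicGeometry.Motives.projectiveSpace N ℂ) [AlgebraicGeometry.IsClosedImmersion ι.left] (L : Set (Fin (N + 1) → ℂ)), (∀ v : (Fin (N + 1) → ℂ), v ∈ L ↔ (∑ i, ‖v i‖ ^ 2 = 1 ∧ ∃ hv : v ≠ 0, Literature.NumberTheory.Transcendental.projPoint N (Projectivization.mk ℂ v hv) ∈ Set.range (Literature.AlgebraicGeometry.Motives.AlgPoints.map ι))) → ∃ π : C(L, Literature.AlgebraicGeometry.Motives.ComplexPoints X), ∀ (v : L) (hv : (v : (Fin (N + 1) → ℂ)) ≠ 0), Literature.AlgebraicGeometry.Motives.AlgPoints.map ι (π v) = Literature.NumberTheory.Transcendental.projPoint N (Projectivization.mk ℂ (v : (Fin (N + 1) → ℂ)) hv)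

/-- item stmt-HodgeConjecture-3354 · support · rank 9 · open · by planner
sources: BoothbyWang1958, Hatcher2002, idea:HodgeConjecture/HodgeConjecture/cr-link-maximally-complex-cycles
[support] THE HYPERPLANE CLASS DIES ON THE LINK, AND NOTHING ELSE (card Corollary H, Gysin
bookkeeping): in the setting of LinkRigidity, if c' ∈ H^{2(1+p)}(X(ℂ);ℂ) has π^*c' = 0 in
H^{2(1+p)}(L;ℂ) then c' = d ∪ b for some d ∈ algebraicClasses X 1 and b ∈ H^{2p}(X(ℂ);ℂ). Proof: π :
L → X(ℂ) is the unit circle bundle of O_X(−1) (restriction of the Hopf fibration S^{2N+1} → ℙ^N(ℂ));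
its Gysin sequence H^{2p}(X) —(∪e)→ H^{2(1+p)}(X) —π^*→ H^{2(1+p)}(L) gives ker π^* = e ∪ H^{2p}(X)
with Euler class e = c_1(O(−1)) = −h, and h = cl(X ∩ H) ∈ algebraicClasses X 1 = N^1H^2 (h vanishes
on X ∖ H, where O(1) is trivial; points of X ∩ H have coheight ≥ 1); take d = h (graded
commutativity in even degrees if the sequence comes as b ∪ e). Known (Bott–Tu §14, Hatcher §4.D,
Milnor–Stasheff §12); Lean-heavy: needs the Gysin / Thom sequence of this concrete circle bundle in
the tree's singular cohomology and e = hyperplane class (tree: LefschetzOneOneChernWeil*,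
ChernClasses). [difficulty: L] -/
@[route_item "route-HodgeConjecture-CrLinkCycles"]
def GysinKernelDivisorial : Prop :=
  ∀ (N n : ℕ) (X : Literature.AlgebraicGeometry.Motives.SchemeOver ℂ), Literature.AlgebraicGeometry.Motives.IsSmoothProjective n X → ∀ (ι : X ⟶ Literature.AlgebraicGeometry.Motives.projectiveSpace N ℂ) [AlgebraicGeometry.IsClosedImmersion ι.left] (L : Set (Fin (N + 1) → ℂ)), (∀ v : (Fin (N + 1) → ℂ), v ∈ L ↔ (∑ i, ‖v i‖ ^ 2 = 1 ∧ ∃ hv : v ≠ 0, Literature.NumberTheory.Transcendental.projPoint N (Projectivization.mk ℂ v hv) ∈ Set.range (Literature.AlgebraicGeometry.Motives.AlgPoints.map ι))) → ∀ (π : C(L, Literature.AlgebraicGeometry.Motives.ComplexPoints X)), (∀ (v : L) (hv : (v : (Fin (N + 1) → ℂ)) ≠ 0), Literature.AlgebraicGeometry.Motives.AlgPoints.map ι (π v) = Literature.NumberTheory.Transcendental.projPoint N (Projectivization.mk ℂ (v : (Fin (N + 1) → ℂ)) hv)) → ∀ (p : ℕ) (c : Literature.AlgebraicGeometry.HodgeTheory.complexBetti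 X (2 * (1 + p))), Literature.AlgebraicTopology.SingularHomology.singularCohomology.map ℂ ℂ π (2 * (1 + p)) c = 0 → ∃ d ∈ Literature.AlgebraicGeometry.HodgeTheory.algebraicClasses X 1, ∃ b : Literature.AlgebraicGeometry.HodgeTheory.complexBetti X (2 * p), c = Literature.AlgebraicTopology.SingularHomology.cupProduct (Nat.mul_add 2 1 p).symm d b

/-- item stmt-HodgeConjecture-3355 · support · rank 9 · closed · proved by Summit.HodgeConjecture.HodgeConjecture.Theorems.crLinkCycles_divisorIdealLift_proof @ 35dd0496de18 (prover) · by planner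
sources: VoisinHodgeI2002, VoisinHodgeII2003, Deligne2000, idea:HodgeConjecture/HodgeConjecture/cr-link-maximally-complex-cycles
[support] X → SUMMIT (card Corollary H): HodgeModels → HodgeModDivisorIdeal → HodgeConjecture.
Proof: model conjunct = HodgeModels; choose ι : X → ℙ^N from IsProjectiveOver; cycle part by
induction on the codimension k: k = 0 is algebraicClasses_zero, 2k > 2n is
subsingleton_complexBetti; for 1 ≤ k = 1+p ≤ n, c rational of type (k,k): HodgeModDivisorIdeal gives
c = z + d ∪ b. RATIONALITY DESCENT: A^k := algebraicClasses X k and A^1 ∪ H^{2p} are ℂ-spans of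
ℚ-subspaces (kernels of restriction maps are defined over ℚ; A^1_ℚ = ℚ-span of divisor classes by
purity in codimension 1) and (V_ℚ ⊗ ℂ) ∩ H_ℚ = V_ℚ, so c = z' + Σ_i cl(D_i) ∪ b_i with z' ∈ A^k_ℚ,
b_i rational. HODGE LIFT: (b_i) ↦ Σ cl(D_i) ∪ b_i is a morphism of polarisable ℚ-Hodge structures; c
− z' is a rational Hodge class in its image (algebraic ⇒ type (k,k), Voisin I 11.20), so by
semisimplicity it has a HODGE preimage (b_i'); induction gives b_i' ∈ A^p; divisor ∪ algebraic is
algebraic (tree: cupProduct_mem_algebraicClasses_of_moving, l = 1, moving discharged by D ∼ H_1 −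
H_2 with H_i very ample moved off the support); hence c ∈ A^k. Known, Lean-heavy: needs 'supported
classes are Hodge' (tree: SupportedClassesHodgeConiveau -/
@[route_item "route-HodgeConjecture-CrLinkCycles"]
def DivisorIdealLift : Prop :=
  HodgeModels → HodgeModDivisorIdeal → _root_.HodgeConjecture

-- item stmt-HodgeConjecture-3428 · support · rank 9 · open · by planner — informal only, no Lean statement yet:
--   [support] CALIBRATION BY HAND (card K6; the route's cheapest falsifier (b); informal until a
--   signature is worth setting): work Theorem T (LinkRigidity) and the Gysin bookkeeping
--   (GysinKernelDivisorial) out explicitly for X = E × E ⊂ ℙ^8 (Segre image of two plane cubics), n = 2,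
--   p = 0, q = 1: the link L is a 5-manifold (circle bundle over E × E with Euler class −h); compute
--   H_3(L;ℚ) ≅ coker/ker of ∩h on H_*(E×E), identify τ = π^! of the graph classes of isogenies E → E
--   (for E with and without CM) and of the two transcendental classes in H^2(E×E), exhibit the closed
--   maximally complex 3-cycles π⁻

/-- item stmt-HodgeConjecture-3356 · assembly · rank 1 · closed · proved by Summit.HodgeConjecture.HodgeConjecture.Theorems.crLinkCycles_assembly_proof @ 86f32985f186 (prover) · by planner
sources: Deligne2000, idea:HodgeConjecture/HodgeConjecture/cr-link-maximally-complex-cycles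
[assembly] HodgeModels → LinkProjectionExists → LinkCycleExistence → LinkRigidity →
GysinKernelDivisorial → DivisorIdealLift → HodgeConjecture (the summit constant is
`_root_.HodgeConjecture`). -/
@[route_item "route-HodgeConjecture-CrLinkCycles"]
def Assembly : Prop :=
  HodgeModels → LinkProjectionExists → LinkCycleExistence → LinkRigidity → GysinKernelDivisorial → DivisorIdealLift → _root_.HodgeConjecture

end Summit.HodgeConjecture.HodgeConjecture.Theses.CrLinkCycles
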